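import Summits.BirchSwinnertonDyer.BirchSwinnertonDyer.Theorems.SchneiderFreeAdditiveX3KYReadHypsBranch
import HarnessLib
import HarnessLib.Audit.Tags

/-!
# Route `SchneiderFreeAdditiveX3` (K1 door), SECOND WING on the (G-ord, `e = 2`) cell — SHORT NAME for the
# value input of the (G-ord) co-socket record IN BRANCH CURRENCY: `KYRead.KYReadCHValueUnit`
# (= door-c3 gen 9's `KYReadCHValue` with a UNIT cofactor)

Cell `bsd-schneider-ideate` (HOME `run/shared/lean/pub/bsd-schneider-ideate/`), seat `door-c5` gen 10.
PARTITION: board row B6 ∩ X3 ∩ sst-twist, `r = 1`, (G-ord, `e = 2`) half (2 560 of 7 101 pairs) of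
`Rank1Residual.partition`; types-the-object-of the value input of the sibling route's crux r3
`GordTwoBranchCoIMC` (the wing's `hCoG`) in the currency in which it is PRINTED; closes nothing (BSD is
not advanced). Theses-free (imports only Theorems defs / Literature), so a route file may import it.

WHY (door-c3 gen 8/9, `door-c3-g8-branch-currency.md`, p494010): the old-currency inputs `KYRead.KYReadCH` /
this seat's gen-9 `KYRead.KYReadCHUnit` ask for a Castella-shape frame `IsBDPLFunction ι′ 𝔭′ κ γ Dt.f …` for the
ADDITIVE curve's newform `Dt.f` — neither printed nor derivable in the tree. The printed object is
Castella–Hsieh's measure for the GOOD-ORDINARY partner `f̃ = Dt′.f` on the `χ_ε`-branch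
(`χ_ε = KellerYin2024.genusHeckeCharacter K p`): a BRANCH frame
`IsBranchBDPLFunction ι′ 𝔭′ κ γ Dt′.f χ_ε e Ω_K Ω_p L` (`BDPBranchPAdicLFunction.lean`). Door-c3 gen 9 re-keyed
the door's value input accordingly (`KYRead.KYReadCHValue`: at every `μ = 0` branch frame there is an
INTEGRAL `u ∈ R₀` with `L(𝟙) = u·(log_{ω_W} Q / c′)²`). This file is the wing's twin:

* `KYReadCHValueUnit` — VERBATIM `KYReadCHValue` with `∃ u : (unrIntegers p)ˣ` (a UNIT cofactor), which the
  upper receptacle genuinely needs (door-c5 gen 8 FINDING; downward any integral `u` works).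

IN PRINT / WHAT IS ASKED: Castella–Hsieh Lemma 5.4 + Thm. 5.7 give `𝓛_ε(𝟙) = u_CH·(log z)²` at THEIR frame
with an explicit `p`-integral constant `u_CH` (Γ-factors at `r₁ = 0` are `1`; the local sign
`ε(½, χ_{ε,𝔭})^{-2}·φ(𝔭′)^{-2}` and the constants `c_o`, `u_K`-type factors), and every `μ = 0` branch frame is
`A·(1+T)^s·𝓛_ε` with `A ∈ R₀^×` GIVEN `μ(𝓛_ε) = 0` (Keller–Yin Thm. 3.5.1); so the UNIT reading holds for every
`μ = 0` frame iff `u_CH ∈ R₀^×` — the ONE print question the upper record raises (door-c5 gen 9 FINDING §5;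
referee g31: «UNIT question = ε·φ valuations, correctly with typer wi-73260»). HONEST FRAMING: a predicate,
conjecture-tagged, nothing asserted; published content in descended shape with a STRENGTHENED (unit) reading
whose page-check is owed; the remaining untyped input of the (G-ord) CO-socket record in branch currency.

References: Castella–Hsieh, Math. Ann. 370 (2018) Lemma 5.4, Thm. 5.7, Prop. 3.8; Keller–Yin arXiv:2410.23241
§3.4, Thm. 3.5.1; Bertolini–Darmon–Prasanna 2013 Thm. 5.13 (shape); Jetchev–Skinner–Wan 2017 §7.4.1.
-/

noncomputable section

open scoped Classical ComplexConjugate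

open WeierstrassCurve NumberField IsDedekindDomain Field PowerSeries
  Literature.NumberTheory.EllipticCurves
  Literature.NumberTheory.EllipticCurves.ModularForms
  Literature.NumberTheory.EllipticCurves.GreenbergSelmer
  Literature.NumberTheory.EllipticCurves.Rank1Residual
  Literature.NumberTheory.EllipticCurves.KellerYin2024
  Literature.NumberTheory.GaloisRepresentations
  Summit.BirchSwinnertonDyer.Rank1Residual
  Summit.BirchSwinnertonDyer.Rank1Residual.X11b
  Summit.BirchSwinnertonDyer.Rank1Residual.X11b.AcSelmer
  Summit.BirchSwinnertonDyer.Rank1Residual.X11b.Halves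

-- D-0017 layout: summit = sub-problem, so `Summit.BirchSwinnertonDyer.BirchSwinnertonDyer.…` is the
-- mandated namespace (same option as the route's sockets files).
set_option linter.dupNamespace false
set_option autoImplicit false

namespace Summit.BirchSwinnertonDyer.BirchSwinnertonDyer.Theorems.SchneiderFree.KYRead

/-- **`KYReadCHValueUnit`** — the VALUE half of the Castella–Hsieh input in branch currency WITH A UNIT
COFACTOR (VERBATIM door-c3 gen 9's `KYReadCHValue` with `∃ u : (unrIntegers p)ˣ`). Same data as
`KYReadCHValue` (the presented door curve `W = C₂ • ((D • W′) ⊗ χ_{p*})`, `W′` good ordinary at `p`, a socket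
datum with `d_K ≠ −3`, the socket's degree-one `𝔭`, a parametrisation datum `Dt′` of `W′`, the conductor-`p`
data over `K[p]`, the conjugate degree-one prime `𝔭′ ≠ 𝔭` and an embedding datum `ι′` inducing it, `K/ℚ`
Galois); CONCLUSION: for EVERY branch frame `(e ≠ 0, Ω_K ≠ 0, Ω_p ∈ R₀^×, L)` of `(Dt′.f, χ_ε)` at `𝔭′` with
`μ(L) = 0` there is a UNIT `u ∈ R₀ˣ` with `L(𝟙) = u · (log_{ω_W}(Q)/c′)²` at every descent `Q ∈ W(K)` of the
genus-twisted conductor-`p` Heegner point (logarithm through `embAt K p 𝔭′`). IN PRINT: Castella–Hsieh Lemma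
5.4 + Thm. 5.7 give the value with an explicit `p`-integral `u_CH`; the UNIT reading (`u_CH ∈ R₀^×`) is the
strengthening the upper direction needs and is NOT page-checked in the tree (typer item wi-73260). A
predicate; nothing asserted; conjecture-tagged.
[cite: CastellaHsieh2018, Lemma 5.4 and Thm. 5.7 (arXiv:1505.08165 pp. 17–19)]
[cite: KellerYin2024b, §3.4 and Thm. 3.5.1 (arXiv:2410.23241 pp. 19–20) (preprint: μ(𝓛_ε) = 0)] -/
@[conjecture]
def KYReadCHValueUnit : Prop :=
  ∀ (p : ℕ) [Fact p.Prime] (W' : WeierstrassCurve ℚ) [W'.IsElliptic] [W'.IsGloballyMinimal]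
    [NeZero (W'.conductorNorm ℤ)] (D C₂ : VariableChange ℚ) [(D • W').IsCharNeTwoNF]
    [(C₂ • (D • W').quadraticTwist ((-1 : ℚ) ^ (p / 2) * p)).IsElliptic]
    [(C₂ • (D • W').quadraticTwist ((-1 : ℚ) ^ (p / 2) * p)).IsGloballyMinimal]
    (N : ℕ) [NeZero N] (K : Type) [Field K] [NumberField K] [IsGalois ℚ K]
    (Dt : ModularParametrizationData (C₂ • (D • W').quadraticTwist ((-1 : ℚ) ^ (p / 2) * p)) N)
    (H : HeegnerDatum N (NumberField.discr K)) (ι : K →+* ℂ)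
    (P : ((C₂ • (D • W').quadraticTwist ((-1 : ℚ) ^ (p / 2) * p)).baseChange K).toAffine.Point),
    (C₂ • (D • W').quadraticTwist ((-1 : ℚ) ^ (p / 2) * p)).analyticRank = 1 →
    Additive.N10.Locus (C₂ • (D • W').quadraticTwist ((-1 : ℚ) ^ (p / 2) * p)) p →
    (C₂ • (D • W').quadraticTwist ((-1 : ℚ) ^ (p / 2) * p)).conductorNorm ℤ = N →
    IsImaginaryQuadratic K → Odd (NumberField.discr K) → ¬ p ∣ Units.torsionOrder K →
    SatisfiesHeegnerHypothesis N K →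
    ((C₂ • (D • W').quadraticTwist ((-1 : ℚ) ^ (p / 2) * p)).quadraticTwist
      (NumberField.discr K : ℚ)).entireLFunction 1 ≠ 0 →
    WeierstrassCurve.Affine.Point.map ι.toRatAlgHom P = heegnerPointComplex Dt H →
    ¬ IsOfFinAddOrder P → p ≠ 2 → GoodOrd W' p → NumberField.discr K ≠ -3 →
    ∀ (κ : ZpExtension K p), κ.IsAnticyclotomic →
    ∀ (γ : Field.absoluteGaloisGroup K) [Fact (κ.IsTopGenerator γ)]
      (𝔭 : HeightOneSpectrum (𝓞 K)) (h𝔭 : ((p : ℕ) : 𝓞 K) ∈ 𝔭.asIdeal)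
      (he : 𝔭.asIdeal.ramificationIdx (𝓞 ℚ) = 1) (hf : 𝔭.asIdeal.inertiaDeg (𝓞 ℚ) = 1),
    ∀ [NumberField (ringClassField K ι p)]
      (Dt' : ModularParametrizationData W' (W'.conductorNorm ℤ)),
    ∀ (𝔭' : HeightOneSpectrum (𝓞 K)) (h𝔭' : ((p : ℕ) : 𝓞 K) ∈ 𝔭'.asIdeal)
      (he' : 𝔭'.asIdeal.ramificationIdx (𝓞 ℚ) = 1) (hf' : 𝔭'.asIdeal.inertiaDeg (𝓞 ℚ) = 1),
    𝔭 ≠ 𝔭' → ∀ (ι' : PadicAlgCl p ≃+* ℂ), BranchInducesPrime p ι' 𝔭' →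
    ∀ (e : ℂ) (ΩK : ℂ) (Ωp : (unrIntegers p)ˣ) (L : UnrSeries p), e ≠ 0 → ΩK ≠ 0 →
      IsBranchBDPLFunction ι' 𝔭' κ γ Dt'.f (KellerYin2024.genusHeckeCharacter K p) e ΩK
        ((Ωp : unrIntegers p) : ℂ_[p]) L →
      ¬ C (p : unrIntegers p) ∣ L →
    ∃ u : (unrIntegers p)ˣ,
      ∀ (y : (W'.baseChange (ringClassField K ι p : Type)).toAffine.Point),
        WeierstrassCurve.Affine.Point.map (ringClassField K ι p).subtype.toRatAlgHom y =
          heegnerPointComplexOfConductor Dt' (NumberField.discr K) H.β p →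
        ∀ (θ : ringClassField K ι p)
          (hθ2 : θ ^ 2 = algebraMap ℚ (ringClassField K ι p) ((-1 : ℚ) ^ (p / 2) * p))
          (hθ : θ ≠ 0) (s : ringClassGal ι p → ℤˣ),
        (∀ σ : ringClassGal ι p, σ.1 θ = ((s σ : ℤ) : ringClassField K ι p) * θ) →
        ∀ Q : ((C₂ • (D • W').quadraticTwist ((-1 : ℚ) ^ (p / 2) * p)).baseChange K).toAffine.Point,
        Affine.Point.map (algebraMap K (ringClassField K ι p)).toRatAlgHom Q =
          VariableChange.pointEquivBaseChange ((D • W').quadraticTwist ((-1 : ℚ) ^ (p / 2) * p)) C₂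
            (ringClassField K ι p)
            ((VariableChange.pointEquiv (((D • W').quadraticTwist
                ((-1 : ℚ) ^ (p / 2) * p)).baseChange (ringClassField K ι p : Type))
                (untwistAt hθ)).symm
              ((Affine.Point.congrEquiv (untwistAt_smul_eq (D • W') hθ2 hθ)).symm
                (VariableChange.pointEquivBaseChange W' D (ringClassField K ι p)
                  (∑ τ : ringClassGal ι p,
                    (s τ : ℤ) • pointGalHom W' (ringClassField K ι p : Type) τ.1 y)))) →
        L.HasValueAt 0 ((((u : unrIntegers p)) : ℂ_[p]) *
          (algebraMap ℚ_[p] ℂ_[p] (logOmega (C₂ • (D • W').quadraticTwist ((-1 : ℚ) ^ (p / 2) * p))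
            p (embAt K p 𝔭' h𝔭' he' hf') Q / (Dt'.c : ℚ_[p]))) ^ 2)


/-! ### Appended (door-c5 gen 11): the Castella–Hsieh (H)(a) LEVEL SCOPE `p ∤ φ(N_{W′})` made explicit

Castella–Hsieh state Hypothesis (H)(a) `p ∤ 2(2r−1)!·N·φ(N)` «throughout» (Math. Ann. 370 (2018) p. 569) and re-impose
it in §4.2 where the classes of Lemma 5.4 / Thm. 5.7 are DEFINED (lit sheet
`pub/bsd-stepL/audit/CH18-VALUE-N1-COFACTOR-lit-g17.md` FLAG F1; referee g34 §1(d) «REQUIRED binder»). Read for the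
good-ordinary partner `W′` (level `N′ = N_{W′}`, weight 2, `p` odd, `p ∤ N′` from `GoodOrd W′ p`) the binder is
`¬ p ∣ φ(N_{W′})`. `KYReadCHValueUnit` above carries none, so a VERBATIM typing of the print (wi-73260 with the binder)
can discharge it only ON THAT SCOPE. The two predicates below SPLIT it: `KYReadCHValueUnitH` (= the print scope;
PUB-typable modulo the descent of the logarithm and Keller–Yin's `μ = 0`) and `KYReadCHValueUnitOffScope` (the
complement `p ∣ φ(N_{W′})`: OUTSIDE Castella–Hsieh's printed standing hypotheses; the `φ(N)`-free alternative
Castella, JIMJ 19 (2020) Thm. A needs `ρ̄_{f̃}|_{G_K}` absolutely irreducible — void here, `W′[p]` is reducible on X3).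
CENSUS (this seat, gen 11): on the door's (G-ord, `e = 2`) cell the scope holds on 557 / 2 560 pairs (21.8 %:
482 / 2 411 at `p = 3`, 75 / 149 at `p ≥ 5`) and fails on 2 003 (78.2 %). `KYReadCHValueUnit ↔ (…UnitH ∧ …UnitOffScope)`.
-/

/-- **`KYReadCHValueUnitH`** — VERBATIM `KYReadCHValueUnit` with ONE binder added after `GoodOrd W′ p`: Castella–Hsieh's
Hypothesis (H)(a) at weight 2 for the partner's level, `¬ p ∣ φ(N_{W′})` (with `p ≠ 2` and `p ∤ N_{W′}` already
present this is `p ∤ 2N′φ(N′)`). This is the predicate a VERBATIM typing of Castella–Hsieh Lemma 5.4 + Thm. 5.7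
(typer item wi-73260, carrying (H)(a)) can discharge by name after the door's descent of the logarithm; on the door's
(G-ord, `e = 2`) cell it covers the pairs with no bad prime `ℓ ≠ p`, `ℓ ≡ 1 (mod p)` (557 of 2 560 in the census).
A predicate; nothing asserted; conjecture-tagged.
[cite: CastellaHsieh2018, Hypothesis (H)(a) p. 569, §4.2, Lemma 5.4 and Thm. 5.7 (arXiv:1505.08165 pp. 3, 12, 17–19)]
[cite: KellerYin2024b, §3.4 and Thm. 3.5.1 (arXiv:2410.23241 pp. 19–20) (preprint: μ(𝓛_ε) = 0)] -/
@[conjecture]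
def KYReadCHValueUnitH : Prop :=
  ∀ (p : ℕ) [Fact p.Prime] (W' : WeierstrassCurve ℚ) [W'.IsElliptic] [W'.IsGloballyMinimal]
    [NeZero (W'.conductorNorm ℤ)] (D C₂ : VariableChange ℚ) [(D • W').IsCharNeTwoNF]
    [(C₂ • (D • W').quadraticTwist ((-1 : ℚ) ^ (p / 2) * p)).IsElliptic]
    [(C₂ • (D • W').quadraticTwist ((-1 : ℚ) ^ (p / 2) * p)).IsGloballyMinimal]
    (N : ℕ) [NeZero N] (K : Type) [Field K] [NumberField K] [IsGalois ℚ K]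
    (Dt : ModularParametrizationData (C₂ • (D • W').quadraticTwist ((-1 : ℚ) ^ (p / 2) * p)) N)
    (H : HeegnerDatum N (NumberField.discr K)) (ι : K →+* ℂ)
    (P : ((C₂ • (D • W').quadraticTwist ((-1 : ℚ) ^ (p / 2) * p)).baseChange K).toAffine.Point),
    (C₂ • (D • W').quadraticTwist ((-1 : ℚ) ^ (p / 2) * p)).analyticRank = 1 →
    Additive.N10.Locus (C₂ • (D • W').quadraticTwist ((-1 : ℚ) ^ (p / 2) * p)) p →
    (C₂ • (D • W').quadraticTwist ((-1 : ℚ) ^ (p / 2) * p)).conductorNorm ℤ = N →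
    IsImaginaryQuadratic K → Odd (NumberField.discr K) → ¬ p ∣ Units.torsionOrder K →
    SatisfiesHeegnerHypothesis N K →
    ((C₂ • (D • W').quadraticTwist ((-1 : ℚ) ^ (p / 2) * p)).quadraticTwist
      (NumberField.discr K : ℚ)).entireLFunction 1 ≠ 0 →
    WeierstrassCurve.Affine.Point.map ι.toRatAlgHom P = heegnerPointComplex Dt H →
    ¬ IsOfFinAddOrder P → p ≠ 2 → GoodOrd W' p →
    ¬ p ∣ Nat.totient (W'.conductorNorm ℤ) → NumberField.discr K ≠ -3 →
    ∀ (κ : ZpExtension K p), κ.IsAnticyclotomic →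
    ∀ (γ : Field.absoluteGaloisGroup K) [Fact (κ.IsTopGenerator γ)]
      (𝔭 : HeightOneSpectrum (𝓞 K)) (h𝔭 : ((p : ℕ) : 𝓞 K) ∈ 𝔭.asIdeal)
      (he : 𝔭.asIdeal.ramificationIdx (𝓞 ℚ) = 1) (hf : 𝔭.asIdeal.inertiaDeg (𝓞 ℚ) = 1),
    ∀ [NumberField (ringClassField K ι p)]
      (Dt' : ModularParametrizationData W' (W'.conductorNorm ℤ)),
    ∀ (𝔭' : HeightOneSpectrum (𝓞 K)) (h𝔭' : ((p : ℕ) : 𝓞 K) ∈ 𝔭'.asIdeal)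
      (he' : 𝔭'.asIdeal.ramificationIdx (𝓞 ℚ) = 1) (hf' : 𝔭'.asIdeal.inertiaDeg (𝓞 ℚ) = 1),
    𝔭 ≠ 𝔭' → ∀ (ι' : PadicAlgCl p ≃+* ℂ), BranchInducesPrime p ι' 𝔭' →
    ∀ (e : ℂ) (ΩK : ℂ) (Ωp : (unrIntegers p)ˣ) (L : UnrSeries p), e ≠ 0 → ΩK ≠ 0 →
      IsBranchBDPLFunction ι' 𝔭' κ γ Dt'.f (KellerYin2024.genusHeckeCharacter K p) e ΩK
        ((Ωp : unrIntegers p) : ℂ_[p]) L →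
      ¬ C (p : unrIntegers p) ∣ L →
    ∃ u : (unrIntegers p)ˣ,
      ∀ (y : (W'.baseChange (ringClassField K ι p : Type)).toAffine.Point),
        WeierstrassCurve.Affine.Point.map (ringClassField K ι p).subtype.toRatAlgHom y =
          heegnerPointComplexOfConductor Dt' (NumberField.discr K) H.β p →
        ∀ (θ : ringClassField K ι p)
          (hθ2 : θ ^ 2 = algebraMap ℚ (ringClassField K ι p) ((-1 : ℚ) ^ (p / 2) * p))
          (hθ : θ ≠ 0) (s : ringClassGal ι p → ℤˣ),
        (∀ σ : ringClassGal ι p, σ.1 θ = ((s σ : ℤ) : ringClassField K ι p) * θ) →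
        ∀ Q : ((C₂ • (D • W').quadraticTwist ((-1 : ℚ) ^ (p / 2) * p)).baseChange K).toAffine.Point,
        Affine.Point.map (algebraMap K (ringClassField K ι p)).toRatAlgHom Q =
          VariableChange.pointEquivBaseChange ((D • W').quadraticTwist ((-1 : ℚ) ^ (p / 2) * p)) C₂
            (ringClassField K ι p)
            ((VariableChange.pointEquiv (((D • W').quadraticTwist
                ((-1 : ℚ) ^ (p / 2) * p)).baseChange (ringClassField K ι p : Type))
                (untwistAt hθ)).symm
              ((Affine.Point.congrEquiv (untwistAt_smul_eq (D • W') hθ2 hθ)).symm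
                (VariableChange.pointEquivBaseChange W' D (ringClassField K ι p)
                  (∑ τ : ringClassGal ι p,
                    (s τ : ℤ) • pointGalHom W' (ringClassField K ι p : Type) τ.1 y)))) →
        L.HasValueAt 0 ((((u : unrIntegers p)) : ℂ_[p]) *
          (algebraMap ℚ_[p] ℂ_[p] (logOmega (C₂ • (D • W').quadraticTwist ((-1 : ℚ) ^ (p / 2) * p))
            p (embAt K p 𝔭' h𝔭' he' hf') Q / (Dt'.c : ℚ_[p]))) ^ 2)

/-- **`KYReadCHValueUnitOffScope`** — VERBATIM `KYReadCHValueUnit` with the COMPLEMENTARY binder `p ∣ φ(N_{W′})`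
added after `GoodOrd W′ p`: the same value-with-unit-cofactor claim on the pairs OUTSIDE Castella–Hsieh's standing
Hypothesis (H)(a) (some bad prime `ℓ ≠ p` of `W` with `ℓ ≡ 1 (mod p)`; 2 003 of the 2 560 (G-ord, `e = 2`) census
pairs, 1 929 of them at `p = 3`). NOT IN PRINT as stated: Castella–Hsieh exclude it by hypothesis; Castella JIMJ 19
(2020) Thm. A drops `φ(N)` but needs `ρ̄|_{G_K}` absolutely irreducible, which fails for the Eisenstein partner `W′`
on X3. Whether the identity nevertheless holds there (e.g. because §5 of Castella–Hsieh does not use the `φ(N)` part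
of (H)(a)) is an OPEN print/mathematics question. A predicate; nothing asserted; conjecture-tagged.
[cite: CastellaHsieh2018, Hypothesis (H)(a) p. 569 and §4.2 (arXiv:1505.08165 pp. 3, 12)]
[cite: Castella2020JIMJ, Thm. A hypotheses (arXiv:1410.6591 p. 3)] -/
@[conjecture]
def KYReadCHValueUnitOffScope : Prop :=
  ∀ (p : ℕ) [Fact p.Prime] (W' : WeierstrassCurve ℚ) [W'.IsElliptic] [W'.IsGloballyMinimal]
    [NeZero (W'.conductorNorm ℤ)] (D C₂ : VariableChange ℚ) [(D • W').IsCharNeTwoNF]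
    [(C₂ • (D • W').quadraticTwist ((-1 : ℚ) ^ (p / 2) * p)).IsElliptic]
    [(C₂ • (D • W').quadraticTwist ((-1 : ℚ) ^ (p / 2) * p)).IsGloballyMinimal]
    (N : ℕ) [NeZero N] (K : Type) [Field K] [NumberField K] [IsGalois ℚ K]
    (Dt : ModularParametrizationData (C₂ • (D • W').quadraticTwist ((-1 : ℚ) ^ (p / 2) * p)) N)
    (H : HeegnerDatum N (NumberField.discr K)) (ι : K →+* ℂ)
    (P : ((C₂ • (D • W').quadraticTwist ((-1 : ℚ) ^ (p / 2) * p)).baseChange K).toAffine.Point),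
    (C₂ • (D • W').quadraticTwist ((-1 : ℚ) ^ (p / 2) * p)).analyticRank = 1 →
    Additive.N10.Locus (C₂ • (D • W').quadraticTwist ((-1 : ℚ) ^ (p / 2) * p)) p →
    (C₂ • (D • W').quadraticTwist ((-1 : ℚ) ^ (p / 2) * p)).conductorNorm ℤ = N →
    IsImaginaryQuadratic K → Odd (NumberField.discr K) → ¬ p ∣ Units.torsionOrder K →
    SatisfiesHeegnerHypothesis N K →
    ((C₂ • (D • W').quadraticTwist ((-1 : ℚ) ^ (p / 2) * p)).quadraticTwist
      (NumberField.discr K : ℚ)).entireLFunction 1 ≠ 0 →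
    WeierstrassCurve.Affine.Point.map ι.toRatAlgHom P = heegnerPointComplex Dt H →
    ¬ IsOfFinAddOrder P → p ≠ 2 → GoodOrd W' p →
    p ∣ Nat.totient (W'.conductorNorm ℤ) → NumberField.discr K ≠ -3 →
    ∀ (κ : ZpExtension K p), κ.IsAnticyclotomic →
    ∀ (γ : Field.absoluteGaloisGroup K) [Fact (κ.IsTopGenerator γ)]
      (𝔭 : HeightOneSpectrum (𝓞 K)) (h𝔭 : ((p : ℕ) : 𝓞 K) ∈ 𝔭.asIdeal)
      (he : 𝔭.asIdeal.ramificationIdx (𝓞 ℚ) = 1) (hf : 𝔭.asIdeal.inertiaDeg (𝓞 ℚ) = 1),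
    ∀ [NumberField (ringClassField K ι p)]
      (Dt' : ModularParametrizationData W' (W'.conductorNorm ℤ)),
    ∀ (𝔭' : HeightOneSpectrum (𝓞 K)) (h𝔭' : ((p : ℕ) : 𝓞 K) ∈ 𝔭'.asIdeal)
      (he' : 𝔭'.asIdeal.ramificationIdx (𝓞 ℚ) = 1) (hf' : 𝔭'.asIdeal.inertiaDeg (𝓞 ℚ) = 1),
    𝔭 ≠ 𝔭' → ∀ (ι' : PadicAlgCl p ≃+* ℂ), BranchInducesPrime p ι' 𝔭' →
    ∀ (e : ℂ) (ΩK : ℂ) (Ωp : (unrIntegers p)ˣ) (L : UnrSeries p), e ≠ 0 → ΩK ≠ 0 →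
      IsBranchBDPLFunction ι' 𝔭' κ γ Dt'.f (KellerYin2024.genusHeckeCharacter K p) e ΩK
        ((Ωp : unrIntegers p) : ℂ_[p]) L →
      ¬ C (p : unrIntegers p) ∣ L →
    ∃ u : (unrIntegers p)ˣ,
      ∀ (y : (W'.baseChange (ringClassField K ι p : Type)).toAffine.Point),
        WeierstrassCurve.Affine.Point.map (ringClassField K ι p).subtype.toRatAlgHom y =
          heegnerPointComplexOfConductor Dt' (NumberField.discr K) H.β p →
        ∀ (θ : ringClassField K ι p)
          (hθ2 : θ ^ 2 = algebraMap ℚ (ringClassField K ι p) ((-1 : ℚ) ^ (p / 2) * p))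
          (hθ : θ ≠ 0) (s : ringClassGal ι p → ℤˣ),
        (∀ σ : ringClassGal ι p, σ.1 θ = ((s σ : ℤ) : ringClassField K ι p) * θ) →
        ∀ Q : ((C₂ • (D • W').quadraticTwist ((-1 : ℚ) ^ (p / 2) * p)).baseChange K).toAffine.Point,
        Affine.Point.map (algebraMap K (ringClassField K ι p)).toRatAlgHom Q =
          VariableChange.pointEquivBaseChange ((D • W').quadraticTwist ((-1 : ℚ) ^ (p / 2) * p)) C₂
            (ringClassField K ι p)
            ((VariableChange.pointEquiv (((D • W').quadraticTwist
                ((-1 : ℚ) ^ (p / 2) * p)).baseChange (ringClassField K ι p : Type))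
                (untwistAt hθ)).symm
              ((Affine.Point.congrEquiv (untwistAt_smul_eq (D • W') hθ2 hθ)).symm
                (VariableChange.pointEquivBaseChange W' D (ringClassField K ι p)
                  (∑ τ : ringClassGal ι p,
                    (s τ : ℤ) • pointGalHom W' (ringClassField K ι p : Type) τ.1 y)))) →
        L.HasValueAt 0 ((((u : unrIntegers p)) : ℂ_[p]) *
          (algebraMap ℚ_[p] ℂ_[p] (logOmega (C₂ • (D • W').quadraticTwist ((-1 : ℚ) ^ (p / 2) * p))
            p (embAt K p 𝔭' h𝔭' he' hf') Q / (Dt'.c : ℚ_[p]))) ^ 2)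

/-- The unscoped value input implies the scoped one (drop the binder). [folklore] -/
theorem kyReadCHValueUnitH_of_unit (h : KYReadCHValueUnit) : KYReadCHValueUnitH := by
  intro p _ W' _ _ _ D C₂ _ _ _ N _ K _ _ _ Dt H ι P hr hloc hN hK hodd hu hHe hL hP hnt hp2 hord _
  exact h p W' D C₂ N K Dt H ι P hr hloc hN hK hodd hu hHe hL hP hnt hp2 hord

/-- The unscoped value input implies the off-scope one (drop the binder). [folklore] -/
theorem kyReadCHValueUnitOffScope_of_unit (h : KYReadCHValueUnit) : KYReadCHValueUnitOffScope := by
  intro p _ W' _ _ _ D C₂ _ _ _ N _ K _ _ _ Dt H ι P hr hloc hN hK hodd hu hHe hL hP hnt hp2 hord _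
  exact h p W' D C₂ N K Dt H ι P hr hloc hN hK hodd hu hHe hL hP hnt hp2 hord

/-- **The split is exhaustive**: the scoped and the off-scope inputs together give back `KYReadCHValueUnit`
(case split on `p ∣ φ(N_{W′})`). [folklore] -/
theorem kyReadCHValueUnit_of_unitH_of_offScope (hH : KYReadCHValueUnitH) (hOff : KYReadCHValueUnitOffScope) :
    KYReadCHValueUnit := by
  intro p _ W' _ _ _ D C₂ _ _ _ N _ K _ _ _ Dt H ι P hr hloc hN hK hodd hu hHe hL hP hnt hp2 hord
  by_cases hφ : p ∣ Nat.totient (W'.conductorNorm ℤ)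
  · exact hOff p W' D C₂ N K Dt H ι P hr hloc hN hK hodd hu hHe hL hP hnt hp2 hord hφ
  · exact hH p W' D C₂ N K Dt H ι P hr hloc hN hK hodd hu hHe hL hP hnt hp2 hord hφ

/-- `KYReadCHValueUnit ↔ KYReadCHValueUnitH ∧ KYReadCHValueUnitOffScope`. [folklore] -/
theorem kyReadCHValueUnit_iff_unitH_and_offScope :
    KYReadCHValueUnit ↔ KYReadCHValueUnitH ∧ KYReadCHValueUnitOffScope :=
  ⟨fun h ↦ ⟨kyReadCHValueUnitH_of_unit h, kyReadCHValueUnitOffScope_of_unit h⟩,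
    fun h ↦ kyReadCHValueUnit_of_unitH_of_offScope h.1 h.2⟩

end Summit.BirchSwinnertonDyer.BirchSwinnertonDyer.Theorems.SchneiderFree.KYRead

end
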